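import Summits.QuantumFields.YangMills.Theorems.AllWindowsColdBoxBulkMidSandwichMeanNearMode
import Mathlib.Analysis.SpecialFunctions.SmoothTransition

/-!
# Local-to-global Hessian sandwich (crux idea `logconcave-core-extension`, first lemma P2, in the form the
# card consumes) — PRELIMINARIES: one-dimensional calculus, the smooth step, segment bounds

Toolkit for `…AllWindowsColdBoxBulkMidLocalToGlobalSandwich` (the extension theorem, sibling file).  Contents:
* §1 one-dimensional second-order calculus: descent `φ(1) ≤ φ(0) + φ'(0) + K/2` from `φ'' ≤ K`
  (`oneD_descent`), the two-sided bound `K₁ ≤ φ(1)+φ(−1)−2φ(0) ≤ K₂` from `K₁ ≤ φ'' ≤ K₂`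
  (`oneD_secondDiff_le` / `oneD_le_secondDiff`), and the segment bounds `|ψ'(1) − ψ'(0)| ≤ K`,
  `|ψ(1) − ψ(0) − ψ'(0)| ≤ K/2` from `|ψ''| ≤ K` on `[0,1]` (`oneD_abs_deriv_sub_le`, `oneD_abs_taylor2_le`).
* §2 the smooth step `Real.smoothTransition`: it, its derivative and its second derivative vanish on
  `(−∞,0)`, and the two derivatives are GLOBALLY bounded by universal constants `M₁, M₂`
  (`exists_bounds_deriv_smoothTransition`).
* §3 Cauchy–Schwarz for `dotProduct` in square-root form and the product-form polarisation of a pointwise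
  Hessian sandwich `|D²Φ(z)(u,w) − u·w| ≤ r·|u|·|w|` (`abs_hess_defect_le_mul`).
* §4 segment bounds for a `C²` function with the Hessian sandwich on a Euclidean ball around `x₀`:
  `|Φ(z) − Φ(x₀) − DΦ(x₀)(z−x₀) − ½|z−x₀|²| ≤ (r/2)|z−x₀|²` and `|DΦ(z)h − DΦ(x₀)h − (z−x₀)·h| ≤ r|z−x₀||h|`.

HONEST SCOPE.  Free-hands work of the LEAD seat of ⟨stmt-QuantumFields-24006⟩ (FCL lineage) on the first
lemma of an UN-TRIAGED crux idea card; pure calculus.  No stub of LINE-18, no crux, rung or summit is proved;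
the Yang–Mills mass gap is NOT proved by any of this.
-/

noncomputable section

namespace Summit.QuantumFields.YangMills.Theorems.LocalToGlobalSandwich

open Real Filter Topology Set
open Summit.QuantumFields.YangMills.Theorems.SandwichVariancePinching

variable {n : ℕ}

/-! ## §1 One-dimensional second-order calculus -/

/-- 1-D DESCENT: `φ'' ≤ K` everywhere gives `φ(1) ≤ φ(0) + φ'(0) + K/2`. [folklore] -/
theorem oneD_descent {φ φ' φ'' : ℝ → ℝ} (h1 : ∀ t, HasDerivAt φ (φ' t) t)
    (h2 : ∀ t, HasDerivAt φ' (φ'' t) t) {K : ℝ} (hK : ∀ t, φ'' t ≤ K) :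
    φ 1 ≤ φ 0 + φ' 0 + K / 2 := by
  have hd : Differentiable ℝ φ' := fun t => (h2 t).differentiableAt
  have hq1 : ∀ t, 0 ≤ t → φ' t - φ' 0 ≤ K * t := fun t ht => by
    have := image_sub_le_mul_sub_of_deriv_le hd (fun s => by rw [(h2 s).deriv]; exact hK s) ht
    simpa using this
  set G : ℝ → ℝ := fun t => φ t - t * φ' 0 - K / 2 * t ^ 2 with hG
  have hG' : ∀ t, HasDerivAt G (φ' t - φ' 0 - K * t) t := by
    intro t
    have ha : HasDerivAt (fun s : ℝ => s * φ' 0) (φ' 0) t := by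
      simpa using hasDerivAt_mul_const (φ' 0) (x := t)
    have hb : HasDerivAt (fun s : ℝ => K / 2 * s ^ 2) (K / 2 * (2 * t)) t := by
      simpa using (hasDerivAt_pow 2 t).const_mul (K / 2)
    have h := ((h1 t).sub ha).sub hb
    have e : φ' t - φ' 0 - K / 2 * (2 * t) = φ' t - φ' 0 - K * t := by ring
    rw [e] at h
    exact h
  have hGc : ContinuousOn G (Ici 0) := fun t _ => (hG' t).continuousAt.continuousWithinAt
  have hGd : DifferentiableOn ℝ G (interior (Ici 0)) := fun t _ =>
    (hG' t).differentiableAt.differentiableWithinAt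
  have hGle : ∀ t ∈ interior (Ici (0:ℝ)), deriv G t ≤ 0 := by
    intro t ht
    rw [interior_Ici] at ht
    rw [(hG' t).deriv]
    have := hq1 t (le_of_lt ht)
    linarith
  have key := (convex_Ici (0:ℝ)).image_sub_le_mul_sub_of_deriv_le hGc hGd hGle 0
    (mem_Ici.mpr le_rfl) 1 (mem_Ici.mpr zero_le_one) zero_le_one
  simp only [hG, zero_mul, sub_zero, one_mul, one_pow, mul_one] at key
  have e0 : (0:ℝ) ^ 2 = 0 := by norm_num
  rw [e0, mul_zero, sub_zero] at key
  linarith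

/-- UPPER SECOND DIFFERENCE from `φ'' ≤ K`: `φ(1) + φ(−1) − 2φ(0) ≤ K`. [folklore] -/
theorem oneD_secondDiff_le {φ φ' φ'' : ℝ → ℝ} (h1 : ∀ t, HasDerivAt φ (φ' t) t)
    (h2 : ∀ t, HasDerivAt φ' (φ'' t) t) {K : ℝ} (hK : ∀ t, φ'' t ≤ K) :
    φ 1 + φ (-1) - 2 * φ 0 ≤ K := by
  have hA := oneD_descent h1 h2 hK
  -- the reflected function `t ↦ φ(−t)`
  have h1' : ∀ t, HasDerivAt (fun s => φ (-s)) (-φ' (-t)) t := fun t => by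
    have := (h1 (-t)).comp t (hasDerivAt_neg t)
    simpa [Function.comp_def] using this
  have hn : ∀ y, HasDerivAt (fun y => -φ' y) (-φ'' y) y := fun y => (h2 y).neg
  have h2' : ∀ t, HasDerivAt (fun s => -φ' (-s)) (φ'' (-t)) t := fun t => by
    have := (hn (-t)).comp t (hasDerivAt_neg t)
    simpa [Function.comp_def] using this
  have hB := oneD_descent h1' h2' (fun t => hK (-t))
  simp only [neg_zero] at hB
  linarith

/-- LOWER SECOND DIFFERENCE from `K ≤ φ''`: `K ≤ φ(1) + φ(−1) − 2φ(0)`. [folklore] -/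
theorem oneD_le_secondDiff {φ φ' φ'' : ℝ → ℝ} (h1 : ∀ t, HasDerivAt φ (φ' t) t)
    (h2 : ∀ t, HasDerivAt φ' (φ'' t) t) {K : ℝ} (hK : ∀ t, K ≤ φ'' t) :
    K ≤ φ 1 + φ (-1) - 2 * φ 0 := by
  have h := oneD_secondDiff_le (φ := fun t => -φ t) (φ' := fun t => -φ' t) (φ'' := fun t => -φ'' t)
    (fun t => (h1 t).neg) (fun t => (h2 t).neg) (K := -K) (fun t => by linarith [hK t])
  linarith

/-- SEGMENT BOUND for the derivative: `|ψ''| ≤ K` on `[0,1]` gives `|ψ'(s) − ψ'(0)| ≤ K·s` on `[0,1]`.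
[folklore] -/
theorem oneD_abs_deriv_sub_le {ψ' ψ'' : ℝ → ℝ} (h2 : ∀ t, HasDerivAt ψ' (ψ'' t) t) {K : ℝ}
    (hK : ∀ t ∈ Icc (0:ℝ) 1, |ψ'' t| ≤ K) {s : ℝ} (hs : s ∈ Icc (0:ℝ) 1) :
    |ψ' s - ψ' 0| ≤ K * s := by
  have h := norm_image_sub_le_of_norm_deriv_le_segment' (f := ψ') (f' := ψ'') (a := 0) (b := 1)
    (fun t _ => (h2 t).hasDerivWithinAt) (fun t ht => by
      rw [Real.norm_eq_abs]; exact hK t (Ico_subset_Icc_self ht)) s hs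
  rw [Real.norm_eq_abs, sub_zero] at h
  exact h

/-- SEGMENT TAYLOR BOUND: `|ψ''| ≤ K` on `[0,1]` gives `|ψ(1) − ψ(0) − ψ'(0)| ≤ K/2`. [folklore] -/
theorem oneD_abs_taylor2_le {ψ ψ' ψ'' : ℝ → ℝ} (h1 : ∀ t, HasDerivAt ψ (ψ' t) t)
    (h2 : ∀ t, HasDerivAt ψ' (ψ'' t) t) {K : ℝ} (hK : ∀ t ∈ Icc (0:ℝ) 1, |ψ'' t| ≤ K) :
    |ψ 1 - ψ 0 - ψ' 0| ≤ K / 2 := by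
  have hdev : ∀ s ∈ Icc (0:ℝ) 1, |ψ' s - ψ' 0| ≤ K * s := fun s hs => oneD_abs_deriv_sub_le h2 hK hs
  -- upper: `G(s) = ψ s − s ψ'(0) − K s²/2` is non-increasing on `[0,1]`
  have hup : ∀ (χ χ' : ℝ → ℝ), (∀ t, HasDerivAt χ (χ' t) t) →
      (∀ s ∈ Icc (0:ℝ) 1, χ' s - χ' 0 ≤ K * s) → χ 1 - χ 0 - χ' 0 ≤ K / 2 := by
    intro χ χ' hχ hχ'
    set G : ℝ → ℝ := fun t => χ t - t * χ' 0 - K / 2 * t ^ 2 with hG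
    have hG' : ∀ t, HasDerivAt G (χ' t - χ' 0 - K * t) t := by
      intro t
      have ha : HasDerivAt (fun s : ℝ => s * χ' 0) (χ' 0) t := by
        simpa using hasDerivAt_mul_const (χ' 0) (x := t)
      have hb : HasDerivAt (fun s : ℝ => K / 2 * s ^ 2) (K / 2 * (2 * t)) t := by
        simpa using (hasDerivAt_pow 2 t).const_mul (K / 2)
      have h := ((hχ t).sub ha).sub hb
      have e : χ' t - χ' 0 - K / 2 * (2 * t) = χ' t - χ' 0 - K * t := by ring
      rw [e] at h
      exact h
    have hGc : ContinuousOn G (Icc 0 1) := fun t _ => (hG' t).continuousAt.continuousWithinAt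
    have hGd : DifferentiableOn ℝ G (interior (Icc 0 1)) := fun t _ =>
      (hG' t).differentiableAt.differentiableWithinAt
    have hGle : ∀ t ∈ interior (Icc (0:ℝ) 1), deriv G t ≤ 0 := by
      intro t ht
      rw [interior_Icc] at ht
      rw [(hG' t).deriv]
      have := hχ' t (Ioo_subset_Icc_self ht)
      linarith
    have key := (convex_Icc (0:ℝ) 1).image_sub_le_mul_sub_of_deriv_le hGc hGd hGle 0
      (left_mem_Icc.mpr zero_le_one) 1 (right_mem_Icc.mpr zero_le_one) zero_le_one
    simp only [hG, zero_mul, sub_zero, one_mul, one_pow, mul_one] at key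
    have e0 : (0:ℝ) ^ 2 = 0 := by norm_num
    rw [e0, mul_zero, sub_zero] at key
    linarith
  have hU := hup ψ ψ' h1 (fun s hs => (abs_le.mp (hdev s hs)).2)
  have hL := hup (fun t => -ψ t) (fun t => -ψ' t) (fun t => (h1 t).neg) (fun s hs => by
    have := (abs_le.mp (hdev s hs)).1; linarith)
  rw [abs_le]; constructor <;> linarith

/-! ## §2 The smooth step and its first two derivatives -/

/-- `smoothTransition` is differentiable, its derivative is differentiable, and the second derivative
is continuous (`C²` unpacked via `contDiff_succ_iff_deriv`). [folklore] -/
theorem smoothTransition_deriv_facts :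
    Differentiable ℝ Real.smoothTransition ∧ Differentiable ℝ (deriv Real.smoothTransition) ∧
      Continuous (deriv (deriv Real.smoothTransition)) := by
  have h2 : ContDiff ℝ 2 Real.smoothTransition := Real.smoothTransition.contDiff
  rw [show (2 : WithTop ℕ∞) = 1 + 1 from rfl, contDiff_succ_iff_deriv] at h2
  obtain ⟨hd, -, h1⟩ := h2
  rw [contDiff_one_iff_deriv] at h1
  exact ⟨hd, h1.1, h1.2⟩

/-- On `(−∞, 0)` the smooth step and its first two derivatives vanish. [folklore] -/
theorem smoothTransition_derivs_zero_of_neg {y : ℝ} (hy : y < 0) :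
    Real.smoothTransition y = 0 ∧ deriv Real.smoothTransition y = 0 ∧
      deriv (deriv Real.smoothTransition) y = 0 := by
  have hev : ∀ z : ℝ, z < 0 → deriv Real.smoothTransition z = 0 := by
    intro z hz
    have h : Real.smoothTransition =ᶠ[𝓝 z] fun _ => (0:ℝ) :=
      Filter.eventually_of_mem (Iio_mem_nhds hz) fun w hw =>
        Real.smoothTransition.zero_of_nonpos (le_of_lt hw)
    rw [h.deriv_eq, deriv_const]
  refine ⟨Real.smoothTransition.zero_of_nonpos hy.le, hev y hy, ?_⟩
  have h : deriv Real.smoothTransition =ᶠ[𝓝 y] fun _ => (0:ℝ) :=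
    Filter.eventually_of_mem (Iio_mem_nhds hy) fun w hw => hev w hw
  rw [h.deriv_eq, deriv_const]

/-- On `(1, ∞)` the first two derivatives of the smooth step vanish. [folklore] -/
theorem smoothTransition_derivs_zero_of_one_lt {y : ℝ} (hy : 1 < y) :
    deriv Real.smoothTransition y = 0 ∧ deriv (deriv Real.smoothTransition) y = 0 := by
  have hev : ∀ z : ℝ, 1 < z → deriv Real.smoothTransition z = 0 := by
    intro z hz
    have h : Real.smoothTransition =ᶠ[𝓝 z] fun _ => (1:ℝ) :=
      Filter.eventually_of_mem (Ioi_mem_nhds hz) fun w hw =>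
        Real.smoothTransition.one_of_one_le (le_of_lt hw)
    rw [h.deriv_eq, deriv_const]
  refine ⟨hev y hy, ?_⟩
  have h : deriv Real.smoothTransition =ᶠ[𝓝 y] fun _ => (0:ℝ) :=
    Filter.eventually_of_mem (Ioi_mem_nhds hy) fun w hw => hev w hw
  rw [h.deriv_eq, deriv_const]

/-- UNIVERSAL BOUNDS for the first two derivatives of the smooth step: there are `M₁, M₂ ≥ 0` with
`|sT'| ≤ M₁` and `|sT''| ≤ M₂` on all of `ℝ` (compactness of `[0,1]`, vanishing outside). [folklore] -/
theorem exists_bounds_deriv_smoothTransition :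
    ∃ M₁ M₂ : ℝ, 0 ≤ M₁ ∧ 0 ≤ M₂ ∧ (∀ y, |deriv Real.smoothTransition y| ≤ M₁) ∧
      ∀ y, |deriv (deriv Real.smoothTransition) y| ≤ M₂ := by
  obtain ⟨_, hd1, hc2⟩ := smoothTransition_deriv_facts
  obtain ⟨C₁, hC₁⟩ := isCompact_Icc.exists_bound_of_continuousOn
    (hd1.continuous.continuousOn (s := Icc (0:ℝ) 1))
  obtain ⟨C₂, hC₂⟩ := isCompact_Icc.exists_bound_of_continuousOn (hc2.continuousOn (s := Icc (0:ℝ) 1))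
  refine ⟨max C₁ 0, max C₂ 0, le_max_right _ _, le_max_right _ _, fun y => ?_, fun y => ?_⟩
  · rcases lt_or_ge y 0 with hy | hy
    · rw [(smoothTransition_derivs_zero_of_neg hy).2.1, abs_zero]; exact le_max_right _ _
    rcases le_or_gt y 1 with hy1 | hy1
    · have := hC₁ y ⟨hy, hy1⟩
      rw [Real.norm_eq_abs] at this
      exact this.trans (le_max_left _ _)
    · rw [(smoothTransition_derivs_zero_of_one_lt hy1).1, abs_zero]; exact le_max_right _ _
  · rcases lt_or_ge y 0 with hy | hy
    · rw [(smoothTransition_derivs_zero_of_neg hy).2.2, abs_zero]; exact le_max_right _ _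
    rcases le_or_gt y 1 with hy1 | hy1
    · have := hC₂ y ⟨hy, hy1⟩
      rw [Real.norm_eq_abs] at this
      exact this.trans (le_max_left _ _)
    · rw [(smoothTransition_derivs_zero_of_one_lt hy1).2, abs_zero]; exact le_max_right _ _

/-! ## §3 Cauchy–Schwarz and the product-form polarisation -/

/-- Cauchy–Schwarz for `dotProduct` in square-root form: `|u·v| ≤ √(u·u)·√(v·v)`. [folklore] -/
theorem abs_dotProduct_le_sqrt_mul_sqrt (u v : Fin n → ℝ) :
    |u ⬝ᵥ v| ≤ Real.sqrt (u ⬝ᵥ u) * Real.sqrt (v ⬝ᵥ v) := by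
  have h : (u ⬝ᵥ v) ^ 2 ≤ (u ⬝ᵥ u) * (v ⬝ᵥ v) := by
    have := Finset.sum_mul_sq_le_sq_mul_sq Finset.univ u v
    simpa only [dotProduct, sq] using this
  have hu : 0 ≤ u ⬝ᵥ u := by simpa using dotProduct_self_star_nonneg u
  rw [← Real.sqrt_mul hu, ← Real.sqrt_sq_eq_abs]
  exact Real.sqrt_le_sqrt h

/-- PRODUCT-FORM POLARISATION of a pointwise Hessian sandwich: if the symmetric bilinear form
`B = D²Φ(z)` satisfies `(1−r)|v|² ≤ B(v,v) ≤ (1+r)|v|²` for all `v`, then `|B(u,w) − u·w| ≤ r·|u|·|w|`.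
[folklore] -/
theorem abs_hess_defect_le_mul {Φ : (Fin n → ℝ) → ℝ} (hΦ : ContDiff ℝ 2 Φ) {r : ℝ} (hr : 0 ≤ r)
    (z : Fin n → ℝ) (hup : ∀ v, fderiv ℝ (fderiv ℝ Φ) z v v ≤ (1 + r) * (v ⬝ᵥ v))
    (hlo : ∀ v, (1 - r) * (v ⬝ᵥ v) ≤ fderiv ℝ (fderiv ℝ Φ) z v v) (u w : Fin n → ℝ) :
    |fderiv ℝ (fderiv ℝ Φ) z u w - u ⬝ᵥ w| ≤ r * Real.sqrt (u ⬝ᵥ u) * Real.sqrt (w ⬝ᵥ w) := by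
  set B := fderiv ℝ (fderiv ℝ Φ) z with hB
  -- polarised sum form for every rescaling `(s•u, w)`
  have hsum : ∀ u' w' : Fin n → ℝ, |B u' w' - u' ⬝ᵥ w'| ≤ r / 2 * (u' ⬝ᵥ u' + w' ⬝ᵥ w') := by
    intro u' w'
    have hdiag : ∀ v : Fin n → ℝ, |B v v - v ⬝ᵥ v| ≤ r * (v ⬝ᵥ v) := fun v => by
      rw [abs_le]; constructor <;> linarith [hup v, hlo v]
    have hsymm : B w' u' = B u' w' := fderiv_fderiv_symm hΦ z w' u'
    have hpol : B u' w' - u' ⬝ᵥ w' = ((B (u' + w') (u' + w') - (u' + w') ⬝ᵥ (u' + w')) -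
        (B (u' - w') (u' - w') - (u' - w') ⬝ᵥ (u' - w'))) / 4 := by
      have h1 : B (u' + w') (u' + w') = B u' u' + B u' w' + B w' u' + B w' w' := by
        simp only [map_add, add_apply]; ring
      have h2 : B (u' - w') (u' - w') = B u' u' - B u' w' - B w' u' + B w' w' := by
        simp only [map_sub, sub_apply]; ring
      have h3 : (u' + w') ⬝ᵥ (u' + w') = u' ⬝ᵥ u' + 2 * (u' ⬝ᵥ w') + w' ⬝ᵥ w' := by
        simp only [add_dotProduct, dotProduct_add, dotProduct_comm w' u']; ring
      have h4 : (u' - w') ⬝ᵥ (u' - w') = u' ⬝ᵥ u' - 2 * (u' ⬝ᵥ w') + w' ⬝ᵥ w' := by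
        simp only [sub_dotProduct, dotProduct_sub, dotProduct_comm w' u']; ring
      rw [h1, h2, h3, h4, hsymm]; ring
    have hs : (u' + w') ⬝ᵥ (u' + w') + (u' - w') ⬝ᵥ (u' - w') = 2 * (u' ⬝ᵥ u' + w' ⬝ᵥ w') := by
      simp only [add_dotProduct, dotProduct_add, sub_dotProduct, dotProduct_sub, dotProduct_comm w' u']
      ring
    rw [hpol, abs_div, abs_of_pos (by norm_num : (0:ℝ) < 4)]
    have ht := abs_sub (B (u' + w') (u' + w') - (u' + w') ⬝ᵥ (u' + w'))
      (B (u' - w') (u' - w') - (u' - w') ⬝ᵥ (u' - w'))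
    have hK : r / 2 * (u' ⬝ᵥ u' + w' ⬝ᵥ w') =
        (r * ((u' + w') ⬝ᵥ (u' + w')) + r * ((u' - w') ⬝ᵥ (u' - w'))) / 4 := by
      rw [← mul_add, hs]; ring
    rw [hK]
    exact div_le_div_of_nonneg_right (ht.trans (add_le_add (hdiag _) (hdiag _))) (by norm_num)
  -- rescale `u ↦ √t•u`, `w ↦ (√t)⁻¹•w` and optimise in `t`
  have key : ∀ t : ℝ, 0 < t → |B u w - u ⬝ᵥ w| ≤ r / 2 * ((w ⬝ᵥ w) / t + t * (u ⬝ᵥ u)) := by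
    intro t ht
    set s : ℝ := Real.sqrt t with hsdef
    have hs : 0 < s := Real.sqrt_pos.mpr ht
    have hss : s * s = t := Real.mul_self_sqrt ht.le
    have h := hsum (s • u) (s⁻¹ • w)
    have e1 : B (s • u) (s⁻¹ • w) = B u w := by
      have hs' : s ≠ 0 := hs.ne'
      simp only [map_smul, FunLike.coe_smul, Pi.smul_apply, smul_eq_mul]
      field_simp
    have e2 : (s • u) ⬝ᵥ (s⁻¹ • w) = u ⬝ᵥ w := by
      rw [smul_dotProduct, dotProduct_smul, smul_eq_mul, smul_eq_mul]; field_simp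
    have e3 : (s • u) ⬝ᵥ (s • u) = t * (u ⬝ᵥ u) := by
      rw [smul_dotProduct, dotProduct_smul, smul_eq_mul, smul_eq_mul, ← mul_assoc, hss]
    have e4 : (s⁻¹ • w) ⬝ᵥ (s⁻¹ • w) = (w ⬝ᵥ w) / t := by
      rw [smul_dotProduct, dotProduct_smul, smul_eq_mul, smul_eq_mul, ← hss]
      field_simp
    rw [e1, e2, e3, e4, add_comm] at h
    exact h
  have hu : 0 ≤ u ⬝ᵥ u := by simpa using dotProduct_self_star_nonneg u
  have hw : 0 ≤ w ⬝ᵥ w := by simpa using dotProduct_self_star_nonneg w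
  have h := meanMode_le_of_forall_pos (c := r / 2) (P := w ⬝ᵥ w) (L := u ⬝ᵥ u) (by linarith) hw hu key
  calc |B u w - u ⬝ᵥ w| ≤ 2 * (r / 2) * Real.sqrt (w ⬝ᵥ w) * Real.sqrt (u ⬝ᵥ u) := h
    _ = r * Real.sqrt (u ⬝ᵥ u) * Real.sqrt (w ⬝ᵥ w) := by ring

/-! ## §4 Segment bounds under a Hessian sandwich on a Euclidean ball -/

/-- Points of the segment from the centre stay in the ball: `|s•v|² ≤ |v|²` for `s ∈ [0,1]`. [folklore] -/
theorem smul_dot_smul_le {v : Fin n → ℝ} {s : ℝ} (hs : s ∈ Icc (0:ℝ) 1) :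
    (s • v) ⬝ᵥ (s • v) ≤ v ⬝ᵥ v := by
  have hv : 0 ≤ v ⬝ᵥ v := by simpa using dotProduct_self_star_nonneg v
  rw [smul_dotProduct, dotProduct_smul, smul_eq_mul, smul_eq_mul, ← mul_assoc]
  have h1 : s * s ≤ 1 := by nlinarith [hs.1, hs.2]
  nlinarith

/-- **SEGMENT TAYLOR BOUND**: if `Φ ∈ C²` has the Hessian sandwich `(1±r)|v|²` at every point of the
Euclidean ball `{z : |z−x₀|² ≤ R}`, then for `z` in that ball
`|Φ(z) − Φ(x₀) − DΦ(x₀)(z−x₀) − ½|z−x₀|²| ≤ (r/2)|z−x₀|²`. [folklore] -/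
theorem abs_taylor2_le_of_ball {Φ : (Fin n → ℝ) → ℝ} (hΦ : ContDiff ℝ 2 Φ) {r R : ℝ}
    (x₀ : Fin n → ℝ)
    (hup : ∀ z, (z - x₀) ⬝ᵥ (z - x₀) ≤ R → ∀ v, fderiv ℝ (fderiv ℝ Φ) z v v ≤ (1 + r) * (v ⬝ᵥ v))
    (hlo : ∀ z, (z - x₀) ⬝ᵥ (z - x₀) ≤ R → ∀ v, (1 - r) * (v ⬝ᵥ v) ≤ fderiv ℝ (fderiv ℝ Φ) z v v)
    {z : Fin n → ℝ} (hz : (z - x₀) ⬝ᵥ (z - x₀) ≤ R) :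
    |Φ z - Φ x₀ - fderiv ℝ Φ x₀ (z - x₀) - 1 / 2 * ((z - x₀) ⬝ᵥ (z - x₀))| ≤
      r / 2 * ((z - x₀) ⬝ᵥ (z - x₀)) := by
  set v := z - x₀ with hv
  set ψ : ℝ → ℝ := fun s => Φ (x₀ + s • v) - Φ x₀ - s * fderiv ℝ Φ x₀ v - s ^ 2 / 2 * (v ⬝ᵥ v) with hψ
  set ψ' : ℝ → ℝ := fun s => fderiv ℝ Φ (x₀ + s • v) v - fderiv ℝ Φ x₀ v - s * (v ⬝ᵥ v) with hψ'
  set ψ'' : ℝ → ℝ := fun s => fderiv ℝ (fderiv ℝ Φ) (x₀ + s • v) v v - v ⬝ᵥ v with hψ''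
  have h1 : ∀ t, HasDerivAt ψ (ψ' t) t := by
    intro t
    have ha := meanMode_hasDerivAt_comp_path hΦ x₀ v t
    have hb : HasDerivAt (fun s : ℝ => s * fderiv ℝ Φ x₀ v) (fderiv ℝ Φ x₀ v) t := by
      simpa using hasDerivAt_mul_const (fderiv ℝ Φ x₀ v) (x := t)
    have hc : HasDerivAt (fun s : ℝ => s ^ 2 / 2 * (v ⬝ᵥ v)) (2 * t / 2 * (v ⬝ᵥ v)) t := by
      have := ((hasDerivAt_pow 2 t).div_const 2).mul_const (v ⬝ᵥ v)
      simpa using this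
    have h := ((ha.sub (hasDerivAt_const t (Φ x₀))).sub hb).sub hc
    have e : fderiv ℝ Φ (x₀ + t • v) v - 0 - fderiv ℝ Φ x₀ v - 2 * t / 2 * (v ⬝ᵥ v) = ψ' t := by
      simp only [hψ']; ring
    rw [e] at h
    exact h
  have h2 : ∀ t, HasDerivAt ψ' (ψ'' t) t := by
    intro t
    have ha := meanMode_hasDerivAt_fderiv_comp_path hΦ x₀ v v t
    have hb : HasDerivAt (fun s : ℝ => s * (v ⬝ᵥ v)) (v ⬝ᵥ v) t := by
      simpa using hasDerivAt_mul_const (v ⬝ᵥ v) (x := t)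
    have h := (ha.sub (hasDerivAt_const t (fderiv ℝ Φ x₀ v))).sub hb
    have e : fderiv ℝ (fderiv ℝ Φ) (x₀ + t • v) v v - 0 - v ⬝ᵥ v = ψ'' t := by
      simp only [hψ'']; ring
    rw [e] at h
    exact h
  have hK : ∀ t ∈ Icc (0:ℝ) 1, |ψ'' t| ≤ r * (v ⬝ᵥ v) := by
    intro t ht
    have hin : (x₀ + t • v - x₀) ⬝ᵥ (x₀ + t • v - x₀) ≤ R := by
      rw [add_sub_cancel_left]; exact (smul_dot_smul_le ht).trans hz
    have hu := hup _ hin v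
    have hl := hlo _ hin v
    simp only [hψ'']
    rw [abs_le]; constructor <;> linarith
  have h := oneD_abs_taylor2_le h1 h2 hK
  have e1 : ψ 1 = Φ z - Φ x₀ - fderiv ℝ Φ x₀ (z - x₀) - 1 / 2 * ((z - x₀) ⬝ᵥ (z - x₀)) := by
    simp only [hψ, one_smul, one_mul, one_pow, hv]
    rw [show x₀ + (z - x₀) = z by abel]
  have e2 : ψ 0 = 0 := by simp [hψ]
  have e3 : ψ' 0 = 0 := by simp [hψ']
  rw [e1, e2, e3, sub_zero, sub_zero] at h
  calc |Φ z - Φ x₀ - fderiv ℝ Φ x₀ (z - x₀) - 1 / 2 * ((z - x₀) ⬝ᵥ (z - x₀))|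
      ≤ r * (v ⬝ᵥ v) / 2 := h
    _ = r / 2 * ((z - x₀) ⬝ᵥ (z - x₀)) := by rw [hv]; ring

/-- **SEGMENT GRADIENT BOUND** (product form): under the same ball sandwich, for `z` in the ball and
any `h`, `|DΦ(z)h − DΦ(x₀)h − (z−x₀)·h| ≤ r·|z−x₀|·|h|`. [folklore] -/
theorem abs_fderiv_defect_le_of_ball {Φ : (Fin n → ℝ) → ℝ} (hΦ : ContDiff ℝ 2 Φ) {r R : ℝ}
    (hr : 0 ≤ r) (x₀ : Fin n → ℝ)
    (hup : ∀ z, (z - x₀) ⬝ᵥ (z - x₀) ≤ R → ∀ v, fderiv ℝ (fderiv ℝ Φ) z v v ≤ (1 + r) * (v ⬝ᵥ v))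
    (hlo : ∀ z, (z - x₀) ⬝ᵥ (z - x₀) ≤ R → ∀ v, (1 - r) * (v ⬝ᵥ v) ≤ fderiv ℝ (fderiv ℝ Φ) z v v)
    {z : Fin n → ℝ} (hz : (z - x₀) ⬝ᵥ (z - x₀) ≤ R) (h : Fin n → ℝ) :
    |fderiv ℝ Φ z h - fderiv ℝ Φ x₀ h - (z - x₀) ⬝ᵥ h| ≤
      r * Real.sqrt ((z - x₀) ⬝ᵥ (z - x₀)) * Real.sqrt (h ⬝ᵥ h) := by
  set v := z - x₀ with hv
  set ψ' : ℝ → ℝ := fun s => fderiv ℝ Φ (x₀ + s • v) h - s * (v ⬝ᵥ h) with hψ'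
  set ψ'' : ℝ → ℝ := fun s => fderiv ℝ (fderiv ℝ Φ) (x₀ + s • v) v h - v ⬝ᵥ h with hψ''
  have h2 : ∀ t, HasDerivAt ψ' (ψ'' t) t := by
    intro t
    have ha := meanMode_hasDerivAt_fderiv_comp_path hΦ x₀ v h t
    have hb : HasDerivAt (fun s : ℝ => s * (v ⬝ᵥ h)) (v ⬝ᵥ h) t := by
      simpa using hasDerivAt_mul_const (v ⬝ᵥ h) (x := t)
    exact ha.sub hb
  have hK : ∀ t ∈ Icc (0:ℝ) 1, |ψ'' t| ≤ r * Real.sqrt (v ⬝ᵥ v) * Real.sqrt (h ⬝ᵥ h) := by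
    intro t ht
    have hin : (x₀ + t • v - x₀) ⬝ᵥ (x₀ + t • v - x₀) ≤ R := by
      rw [add_sub_cancel_left]; exact (smul_dot_smul_le ht).trans hz
    exact abs_hess_defect_le_mul hΦ hr _ (hup _ hin) (hlo _ hin) v h
  have hmain := oneD_abs_deriv_sub_le h2 hK (s := 1) (right_mem_Icc.mpr zero_le_one)
  have e1 : ψ' 1 = fderiv ℝ Φ z h - v ⬝ᵥ h := by
    simp only [hψ', one_smul, one_mul, hv]
    rw [show x₀ + (z - x₀) = z by abel]
  have e2 : ψ' 0 = fderiv ℝ Φ x₀ h := by simp [hψ']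
  rw [e1, e2, mul_one] at hmain
  have e3 : fderiv ℝ Φ z h - v ⬝ᵥ h - fderiv ℝ Φ x₀ h = fderiv ℝ Φ z h - fderiv ℝ Φ x₀ h - (z - x₀) ⬝ᵥ h := by
    rw [hv]; ring
  rw [e3] at hmain
  exact hmain

end Summit.QuantumFields.YangMills.Theorems.LocalToGlobalSandwich

end
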